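import Summits.ResolutionOfSingularities.ResolutionOfSingularities.Theses.WildCones
import HarnessLib

/-!
# Crux `ClassicalRegimes` (stmt-ResolutionOfSingularities-16884) — birth skeleton (BC3), line `birth`

Route `ResolutionOfSingularities/WildCones`, crux #5 (rank 5, difficulty M):
`ClassicalRegimes` = "the TARGET `IsolatedForcedTermination` restricted to the classical regimes
`n ≤ 2 ∨ p = 2`: for a prime `p`, `0 < n`, `(n ≤ 2 ∨ p = 2)` and a perfect field `κ` of
characteristic `p`, no start coefficient function `c₀ : (Fin n → ℕ) → κ`, chart word `i` and
translation word `t` make EVERY state of the point-blow-up dynamics of the height-one atom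
`z^p = a(u_1..u_n)` (blow up the closed point, divide by `u_i^p`, translate, delete `p`-th-power
monomials) isolated (`κ[[u]]/(∂a)` finite over `κ`) of multiplicity `p` (cleaned order `≥ p`)."

## The cut (three named stubs, one per classical mechanism; `ClassicalRegimes_of` proved)

The crux text itself names three mechanisms, one per regime, and the route header's TWO-LAYER PLAN
foresees exactly the glued split `ClassicalRegimes ⇐ CharTwoSuspension → LowDimRuns →
ClassicalRegimes`. This skeleton types that split over ONE local predicate `InfRun p n κ c₀ i t`
(= "every state of the run from `c₀` along `i`, `t` is isolated of multiplicity `p`"; its body is the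
route items' `let`-calculus VERBATIM, so `ClassicalRegimes ↔ ∀ …, ¬ InfRun …` holds by `Iff.rfl`,
theorem `classicalRegimes_iff`), with `LowDimRuns` cut along its two different mechanisms:

* `stub_planeCurveRuns` — **n = 1 (plane curves `z^p + a(u)`; ELEMENTARY, size S–M in Lean).**
  With one variable `bl` and `tr` are the identity (empty `univ.erase i`, `D i = 0` forces `D = 0`),
  a cleaned non-zero `a(u)` has finite order `≥ p + 1` under `MultP` (the monomial `u^p` is cleaned
  away), and each step divides by `u^p`: the cleaned order drops by exactly `p` per step, so no run
  keeps `MultP` for ever (isolatedness is not even needed). Refuter/grounder notes on the item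
  (2026-08-16): "n = 1 immediate from the encoding". It is a stub and not glue because the
  `sInf`-order / `Finset.sum`-translation bookkeeping of the typed calculus is real Lean work and
  is shared by nobody else.
* `stub_lipmanSurfaceRuns` — **n = 2 (surfaces `z^p + a(u₁,u₂)`; KNOWN ∘ dictionary, size M–L).**
  Every state of an isolated chain is a normal surface germ (isolated hypersurface singularity ⇒
  S₂ + R₁), and the next state is a local ring of the blow-up of its closed point, which is again
  normal when it is again an isolated hypersurface point; so an infinite run is an infinite branch
  of Lipman's "blow up the singular points and normalise" tower of an excellent normal surface,
  contradicting Lipman 1978 (Liu 2002 Thm. 8.3.44, for EXCELLENT reduced Noetherian schemes of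
  dimension 2 — the germs here are formal, `Spec κ[[u₁,u₂]][z]/(z^p + a_m)`, so the in-tree
  finite-type restriction `Literature.AlgebraicGeometry.Resolution.Lipman1978SequenceFinite` does
  not cover them: vendor the printed excellent form, or use CJS 2020 Cor. 6.18
  (`CossartJannsenSaito2020_corollary_6_18`, excellent, in tree) with a domination argument; the
  stub is typed UNCONDITIONALLY and its expected first milestone is a conditional Theorems file
  `(h : <fact>) → <stub statement>`, which the gate records as conditional). Why it might fail AS
  TYPED: the dictionary state ↦ local ring of the strict transform must be exact (`u_i^p` is
  divided only at cleaned order `≥ p`; translations are `κ`-rational, `κ` perfect; completion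
  commutes with the point blow-up) — the crux's own named risk for n = 2.
* `stub_charTwoSuspension` — **p = 2, n ≥ 3 (DESCENT IN THE NUMBER OF VARIABLES; the NEW part,
  size M).** Over a perfect field of characteristic 2, an infinite run in `n ≥ 3` variables all of
  whose states are isolated double points yields such a run in fewer (but positively many)
  variables. Mechanism: a state of cleaned order `≥ 3` has no isolated multiplicity-2 successor
  when `n ≥ 3` (Case A, char-free: after the step `∂a' ⊆ (u_i, b(u'))`, a locus of dimension
  `≥ n − 2 ≥ 1`, unless `b(τ') ≠ 0`, which drops the order to 1), so every state has cleaned order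
  exactly 2; its quadratic part is a non-zero ALTERNATING form (squares are cleaned), so a
  hyperbolic pair `u₁u₂` splits off over `κ[[u]]` (splitting lemma in characteristic 2 over a
  perfect field: Greuel–Pfister, J. Algebra 689 (2026) = arXiv:2507.17078, Thm 3.5 / Cor 3.7;
  Greuel–Kröning doi:10.1007/bf02570742), and a step keeps multiplicity 2 only if its chart is a
  `g`-variable and its translation has no `u₁,u₂`-component, where the dynamics of
  `z² + u₁u₂ + g(u'')` IS the dynamics of `z² + g(u'')` (suspension): the `g`-parts form a run of
  the `(n−2)`-variable dynamics, isolated and of multiplicity 2 at every stage. Why it might fail: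
  the splitting must be re-done after every translation (translation may un-split the quadratic
  part) and the re-splitting coordinate change must be shown to commute with chart choice,
  division and cleaning while preserving `Isol` — unprinted (grounder note 2026-08-16: "suspension +
  Case-A exit NEW"). Typed with `∃ n' < n, 0 < n'` (not `n' = n − 2`) so that splitting off several
  hyperbolic pairs at once, or any other descent, also closes it.
* The assembly `ClassicalRegimes_of : Sig.stub_planeCurveRuns → Sig.stub_lipmanSurfaceRuns →
  Sig.stub_charTwoSuspension → ClassicalRegimes` is PROVED (no `sorry` in its own term): rewrite the
  crux through `classicalRegimes_iff`, strong induction on `n`; `n ≤ 2` is stubs 1–2 (any `p`), and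
  for `p = 2`, `n ≥ 3` stub 3 hands the run down to some `n' < n`, closed by the induction
  hypothesis. `ClassicalRegimes_proof : ClassicalRegimes` is the same with the `stub_*` plugged in.

Honest logical status: given stubs 1–2, stub 3 is EQUIVALENT to the `p = 2` half of the crux (a
least counterexample in `n` would have nowhere to descend), so the cut loses nothing and adds no
falsity risk beyond the crux; none of the three stubs alone gives the crux (each misses a regime)
or the summit — BC3 probes in `bc/ClassicalRegimes_bc3_probes*.lean`, all FAIL as required.

Disproof used: none on file for this crux (`ledger crux ls stmt-ResolutionOfSingularities-16884`:
"(no workfiles yet)" on 2026-08-17; `ledger negatives --problem ResolutionOfSingularities` checked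
this session). The p = 2 contact-form example `u₁u₂ + u₃²u₄ + u₄⁵ + u₃⁷` (route header) refutes
`ConeExit` at p = 2, not this item (refuter note on the item, 2026-08-16).
-/

noncomputable section

-- single-problem summit: the doubled namespace component `ResolutionOfSingularities` is forced
set_option linter.dupNamespace false

open Summit.ResolutionOfSingularities.ResolutionOfSingularities.Theses.WildCones (ClassicalRegimes)

namespace Summit.ResolutionOfSingularities.ResolutionOfSingularities.Cruxes.ClassicalRegimes.Lines.Birth

/-! ## The run predicate (the route items' `let`-calculus, verbatim) -/

/-- **Infinite isolated multiplicity-`p` run.** `InfRun p n κ c₀ i t`: every state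
`run c₀ i t m` (`m : ℕ`) of the point-blow-up dynamics of the height-one atom `z^p = a(u_1..u_n)`
started at the coefficient function `c₀`, with chart word `i` and translation word `t`, is
isolated (`Isol`: `κ[[u]]/(∂a)` finite over `κ`) of multiplicity `p` (`MultP`: cleaned series
non-zero of order `≥ p`). The twelve `let`s are those of `WildCones.ClassicalRegimes` /
`IsolatedForcedTermination` verbatim, so `ClassicalRegimes` is `∀ …, ¬ InfRun …` definitionally
(`classicalRegimes_iff`). [cite: arXiv:1802.05010, §1 (forced point centres); Kollar2007, Ch. 3] -/
def InfRun (p n : ℕ) (κ : Type) [Field κ] (c₀ : (Fin n → ℕ) → κ) (i : ℕ → Fin n)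
    (t : ℕ → Fin n → κ) : Prop :=
    let clean : ((Fin n → ℕ) → κ) → ((Fin n → ℕ) → κ) := fun c A => @ite κ (∀ j, p ∣ A j)
        (Classical.dec _) 0 (c A);
    let bl : Fin n → ((Fin n → ℕ) → κ) → ((Fin n → ℕ) → κ) := fun i c B => @ite κ (Finset.sum
        (Finset.univ.erase i) (fun j => B j) ≤ B i) (Classical.dec _) (c (Function.update B i (B i -
        Finset.sum (Finset.univ.erase i) (fun j => B j)))) 0;
    let ord : ((Fin n → ℕ) → κ) → ℕ := fun c => sInf {m : ℕ | ∃ A, c A ≠ 0 ∧ m = Finset.sum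
        Finset.univ (fun j => A j)};
    let dv : Fin n → ℕ → ((Fin n → ℕ) → κ) → ((Fin n → ℕ) → κ) := fun i s c B => c (Function.update
        B i (B i + s));
    let tr : Fin n → (Fin n → κ) → ℕ → ((Fin n → ℕ) → κ) → ((Fin n → ℕ) → κ) := fun i τ s c B =>
        Finset.sum (Fintype.piFinset (fun _ : Fin n => Finset.range (B i + s + 1))) (fun D => @ite κ
        (D i = 0) (Classical.dec _) (c (B + D) * Finset.prod (Finset.univ.erase i) (fun j =>
        ((Nat.choose (B j + D j) (B j) : ℕ) : κ) * τ j ^ (D j))) 0);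
    let step : Fin n → (Fin n → κ) → ((Fin n → ℕ) → κ) → ((Fin n → ℕ) → κ) := fun i τ c => clean (tr
        i τ (@ite ℕ (p ≤ ord (clean c)) (Classical.dec _) p 0) (dv i (@ite ℕ (p ≤ ord (clean c))
        (Classical.dec _) p 0) (bl i (clean c))));
    let run : ((Fin n → ℕ) → κ) → (ℕ → Fin n) → (ℕ → Fin n → κ) → ℕ → ((Fin n → ℕ) → κ) := fun c₀ i
        t m => @Nat.rec (fun _ => (Fin n → ℕ) → κ) c₀ (fun m c => step (i m) (t m) c) m;
    let ser : ((Fin n → ℕ) → κ) → MvPowerSeries (Fin n) κ := fun c => show MvPowerSeries (Fin n) κ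
        from fun A : Fin n →₀ ℕ => clean c ⇑A;
    let pd : Fin n → MvPowerSeries (Fin n) κ → MvPowerSeries (Fin n) κ := fun i f => show
        MvPowerSeries (Fin n) κ from fun A : Fin n →₀ ℕ => ((A i + 1 : ℕ) : κ) * f (A +
        Finsupp.single i 1);
    let jac : ((Fin n → ℕ) → κ) → Ideal (MvPowerSeries (Fin n) κ) := fun c => Ideal.span (Set.range
        (fun i => pd i (ser c)));
    let Isol : ((Fin n → ℕ) → κ) → Prop := fun c => Module.Finite κ (MvPowerSeries (Fin n) κ ⧸ jac
        c);
    let MultP : ((Fin n → ℕ) → κ) → Prop := fun c => (∃ A, clean c A ≠ 0) ∧ ∀ A, clean c A ≠ 0 → p ≤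
        Finset.sum Finset.univ (fun j => A j);
    ∀ m, Isol (run c₀ i t m) ∧ MultP (run c₀ i t m)

/-- **The crux, re-pointed at `InfRun`** — definitional (`Iff.rfl`: same `let`-calculus, ζ/δ). -/
theorem classicalRegimes_iff :
    ClassicalRegimes ↔
      ∀ p : ℕ, p.Prime → ∀ n : ℕ, 0 < n → (n ≤ 2 ∨ p = 2) → ∀ (κ : Type) [Field κ] [CharP κ p]
        [PerfectField κ] (c₀ : (Fin n → ℕ) → κ) (i : ℕ → Fin n) (t : ℕ → Fin n → κ),
        ¬ InfRun p n κ c₀ i t :=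
  Iff.rfl

/-! ## The three stub STATEMENTS by name (`Sig.stub_<name>`; the composition `ClassicalRegimes_of`
takes exactly these as hypotheses) -/

/-- Statement of `stub_planeCurveRuns` (regime `n = 1`, every prime `p`): no infinite isolated
multiplicity-`p` run of the dynamics of a plane curve `z^p + a(u)` over a perfect field of
characteristic `p` — the cleaned order drops by exactly `p` at every step. [folklore] -/
def Sig.stub_planeCurveRuns : Prop :=
  ∀ p : ℕ, p.Prime → ∀ (κ : Type) [Field κ] [CharP κ p] [PerfectField κ] (c₀ : (Fin 1 → ℕ) → κ)
    (i : ℕ → Fin 1) (t : ℕ → Fin 1 → κ), ¬ InfRun p 1 κ c₀ i t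

/-- Statement of `stub_lipmanSurfaceRuns` (regime `n = 2`, every prime `p`): no infinite isolated
multiplicity-`p` run of the dynamics of a surface `z^p + a(u₁,u₂)` over a perfect field of
characteristic `p` — an infinite run would be an infinite branch of Lipman's blow-up-and-normalise
tower of a normal excellent surface. [cite: Lipman1978, Thm. (p. 151); Liu2002, Thm. 8.3.44] -/
def Sig.stub_lipmanSurfaceRuns : Prop :=
  ∀ p : ℕ, p.Prime → ∀ (κ : Type) [Field κ] [CharP κ p] [PerfectField κ] (c₀ : (Fin 2 → ℕ) → κ)
    (i : ℕ → Fin 2) (t : ℕ → Fin 2 → κ), ¬ InfRun p 2 κ c₀ i t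

/-- Statement of `stub_charTwoSuspension` (regime `p = 2`, `n ≥ 3`): over a perfect field of
characteristic `2`, an infinite isolated double-point run in `n ≥ 3` variables yields one in some
smaller positive number of variables (Case-A exit at cleaned order `≥ 3`; Morse splitting modulo
squares of the alternating quadratic part; the suspended dynamics of `z² + u₁u₂ + g(u'')` is the
dynamics of `z² + g(u'')`). [cite: arXiv:2507.17078, Thm. 3.5 and Cor. 3.7; doi:10.1007/bf02570742] -/
def Sig.stub_charTwoSuspension : Prop :=
  ∀ n : ℕ, 3 ≤ n → ∀ (κ : Type) [Field κ] [CharP κ 2] [PerfectField κ] (c₀ : (Fin n → ℕ) → κ)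
    (i : ℕ → Fin n) (t : ℕ → Fin n → κ), InfRun 2 n κ c₀ i t →
      ∃ n' : ℕ, 0 < n' ∧ n' < n ∧ ∃ (c₀' : (Fin n' → ℕ) → κ) (i' : ℕ → Fin n') (t' : ℕ → Fin n' → κ),
        InfRun 2 n' κ c₀' i' t'

/-! ## Sanity (proved): each stub statement is a CONSEQUENCE of the crux, so the cut is lossless —
`Sig.stub_planeCurveRuns ∧ Sig.stub_lipmanSurfaceRuns ∧ Sig.stub_charTwoSuspension ↔
ClassicalRegimes` (with `ClassicalRegimes_of` below); no stub is STRONGER than the crux, and none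
alone gives it back (BC3 probes). -/

/-- The three stub statements follow from the crux: stubs 1–2 are its regimes `n = 1`, `n = 2`;
stub 3 holds vacuously under the crux's regime `p = 2` (no run to descend). [folklore] -/
theorem stubs_of_classicalRegimes (h : ClassicalRegimes) :
    Sig.stub_planeCurveRuns ∧ Sig.stub_lipmanSurfaceRuns ∧ Sig.stub_charTwoSuspension := by
  rw [classicalRegimes_iff] at h
  refine ⟨fun p hp κ _ _ _ c₀ i t => h p hp 1 one_pos (Or.inl (by norm_num)) κ c₀ i t,
    fun p hp κ _ _ _ c₀ i t => h p hp 2 two_pos (Or.inl le_rfl) κ c₀ i t,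
    fun n hn κ _ _ _ c₀ i t hrun => ?_⟩
  exact absurd hrun (h 2 Nat.prime_two n (by omega) (Or.inr rfl) κ c₀ i t)

/-! ## The stubs -/

/-- **STUB (n = 1; elementary, size S–M).** Plane curves: one-variable runs lose cleaned order `p`
per step (module docstring). [folklore] -/
theorem stub_planeCurveRuns :
    ∀ p : ℕ, p.Prime → ∀ (κ : Type) [Field κ] [CharP κ p] [PerfectField κ] (c₀ : (Fin 1 → ℕ) → κ)
    (i : ℕ → Fin 1) (t : ℕ → Fin 1 → κ), ¬ InfRun p 1 κ c₀ i t := by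
  sorry

/-- **STUB (n = 2; known ∘ dictionary, size M–L).** Surfaces: Lipman 1978 through the dictionary
"isolated state ↦ complete normal local ring `κ[[u₁,u₂]][z]/(z^p + a_m)` of the strict transform;
step ↦ local ring of the point blow-up at the next (κ-rational) closed point, completed" (module
docstring). Expected closure path: a CONDITIONAL Theorems file `(hL : <Lipman 1978 for excellent
reduced Noetherian schemes of dimension 2, Liu 2002 Thm. 8.3.44 verbatim>) → <this statement>`
(the gate records it as conditional), the fact vendored in `Literature/AlgebraicGeometry/Resolution`
— NOTE the in-tree restriction `Lipman1978SequenceFinite` (finite type over a field) does NOT cover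
these formal germs; alternatively CJS 2020 Cor. 6.18 (`CossartJannsenSaito2020_corollary_6_18`,
excellent, in tree) plus a domination argument along the chain's valuation.
[cite: Lipman1978, Thm. (p. 151); Liu2002, Thm. 8.3.44] -/
theorem stub_lipmanSurfaceRuns :
    ∀ p : ℕ, p.Prime → ∀ (κ : Type) [Field κ] [CharP κ p] [PerfectField κ] (c₀ : (Fin 2 → ℕ) → κ)
    (i : ℕ → Fin 2) (t : ℕ → Fin 2 → κ), ¬ InfRun p 2 κ c₀ i t := by
  sorry

/-- **STUB (p = 2, n ≥ 3; the new part, size M).** Char-two suspension / descent in the number of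
variables (module docstring). [cite: arXiv:2507.17078, Thm. 3.5 and Cor. 3.7] -/
theorem stub_charTwoSuspension :
    ∀ n : ℕ, 3 ≤ n → ∀ (κ : Type) [Field κ] [CharP κ 2] [PerfectField κ] (c₀ : (Fin n → ℕ) → κ)
    (i : ℕ → Fin n) (t : ℕ → Fin n → κ), InfRun 2 n κ c₀ i t →
      ∃ n' : ℕ, 0 < n' ∧ n' < n ∧ ∃ (c₀' : (Fin n' → ℕ) → κ) (i' : ℕ → Fin n') (t' : ℕ → Fin n' → κ),
        InfRun 2 n' κ c₀' i' t' := by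
  sorry

/-! ## The composition (kernel-checked; no `sorry` in its own term) -/

/-- **`ClassicalRegimes` from the three stub statements** — the assembly, PROVED: re-point the crux
at `InfRun` (`classicalRegimes_iff`), strong induction on the number of variables `n`; `n ≤ 2` is
stubs 1–2 for every `p`, and for `p = 2`, `n ≥ 3` stub 3 descends the run to some `0 < n' < n`,
which the induction hypothesis (regime `p = 2`) forbids. [folklore] -/
theorem ClassicalRegimes_of :
    Sig.stub_planeCurveRuns → Sig.stub_lipmanSurfaceRuns → Sig.stub_charTwoSuspension →
      ClassicalRegimes := by
  intro h1 h2 h3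
  rw [classicalRegimes_iff]
  intro p hp n
  induction n using Nat.strong_induction_on with
  | _ n ih =>
    intro hn hreg κ _ _ _ c₀ i t hrun
    by_cases hle : n ≤ 2
    · interval_cases n
      · exact h1 p hp κ c₀ i t hrun
      · exact h2 p hp κ c₀ i t hrun
    · rcases hreg with hle' | rfl
      · exact hle hle'
      · obtain ⟨n', hn'0, hn'lt, c₀', i', t', hrun'⟩ := h3 n (by omega) κ c₀ i t hrun
        exact ih n' hn'lt hn'0 (Or.inr rfl) κ c₀' i' t' hrun'

/-- **The crux `ClassicalRegimes`, assembled from the three registered stubs** (the skeleton in its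
final shape: `ClassicalRegimes_of` with the `stub_*` plugged in; the only `sorry`s in its closure
are the three stubs, none of its own). -/
theorem ClassicalRegimes_proof : ClassicalRegimes :=
  ClassicalRegimes_of stub_planeCurveRuns stub_lipmanSurfaceRuns stub_charTwoSuspension

end Summit.ResolutionOfSingularities.ResolutionOfSingularities.Cruxes.ClassicalRegimes.Lines.Birth

end
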